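import Literature.MathematicalPhysics.QuantumFieldTheory.Balaban1983to89.Node00.BgRemainderOfRecord
import HarnessLib

/-!
# [B11] (44) AT THE RECORD — THE FAMILY `C_j` (`j = 0, …, k`) OF NONLINEAR CONSTRAINT REMAINDERS: `CjOfRecord` ∕ `CslJOfRecord`
# (the level-`j` twin of node00-def-Y's 3e′ `COfRecord` ∕ 3f′ `CslOfRecord`; ★★★ director-ym №578 (1) (F-β) DEFINITION EDITION; ★ PT-B g7 located fact (F-β))

Cell `ym-nodeO-ideate` ∕ `pub-ymgap`, DEFINER seat `ym-nodeO-def-1` (gen 39); `--kind definition --supports stmt-QuantumFields-27238 --as helper`; count-neutral.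
[B11] = [Balaban1985Variational], [B9] = [Balaban1985BackgroundPropagators], [RG1] = [Balaban1987RG1].

THE PRINTED TEXT ([B11] p.285, held `paper:balaban1985-cmp102-variational-background`): «The Proposition 4 of [4] implies  Q̄_j(L^jηA) = L^jηQ_jA + C_j(L^jηA),
|C_j(L^jηA)| ≤ C₂(L^jη)²|A|².  (44)»; p.281 (20) «Q_j(U₀, ηA) = B on Λ_j, j = 0, 1, …, k»; (19) «U′ = exp(iηA′)», η = L^{−k}.

WHY (★ PT-B g7's located fact (F-β), `PORT-PLAN-v5.md` :16–:22).  3e′'s `COfRecord F N K k Ω U₀ levB` is `C_k` — the `k`-fold average EVERYWHERE, output weight `1` — which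
is print's object only in the node-00 regime `Ω_k = T` (no large-field regions); for a GENUINE profile `Ω` the letter `Prop4LetterCAtRecord … C₂ c₄` with k-free constants is
false as typed (witness `U₀ = 1`, `Ω 0 = univ`, `Ω j = ∅ (j ≥ 1)`, `A ≡ (x∕η_k)·T`).  Print's object is the FAMILY `C_j`: on `Λ_j` the constraint is imposed after `j`
averagings, with the scaling `L^jη`.  This file types that family; PT-B's general-Ω edition of (ℓa-C) (locality + F4′∕F5 at `k := j` verbatim) consumes it by name.

WHAT THIS FILE IS (definitions + `rfl`∕one-line faces + the level-`j` copies of 3e′'s analyticity lemmas; NEW names; nothing of 3e′∕3f′ touched):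
* ★ `CjOfRecord F N K k Ω U₀ j levB : Space115Lit F N K k Ω U₀ → NegSize L η_k levB 0 M_N(ℂ)`:
  `C_j(A′)(c) := (1∕i)·log( Ū^j_h(exp(iη_kA′)·U₀)(c) · (Ū^jU₀)(c)⋆ ) − (L^j·η_k)·(Q_j(U₀)A′)(c)` on EVERY level-`j` bond `c` — 3e′'s formula with `k ↦ j` in the AVERAGING
  (`iterMh j`, `Averaging.iter (avOfRecord F N K) j`, `qCplxOp j U₀` = the `L^{-j}`-normalised linearised `j`-fold average of [B9] (3.13)) and the chart spacing KEPT at `η_k`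
  ((19), `η = L^{-k}`); the linear part carries print's factor `L^jη` of (44) (`= 1` at `j = k`: `CjOfRecord_top`).  Restriction to the `Λ_j`-blocks is the consumer's (by `Ω`∕`levB`);
  the definition is total on level-`j` bonds.  OUTPUT WEIGHT: `NegSize … levB 0` (weight `(L^{levB c}η_k)^0 = 1`), so (44) reads `‖C_j(A′)‖_{(−0)} ≤ C₂·‖A′‖²` on `Λ_j`, where (115) gives
  `‖η_kA′_b‖ ≤ r·L^{−j}` and the `j`-fold average rescales by `L^j` — the «(L^jη)-class» scaling lives in the factor and the average, not in a new norm.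
* faces `CjOfRecord_apply` (`rfl`), ★ `CjOfRecord_top : CjOfRecord … k levB = COfRecord … levB`, `CjOfRecord_zero` (under `SmallBelow … j U₀`), ★ `analyticAt_CjOfRecord`
  (3e′'s polydisc∕log-disc hypotheses at level `j`; same proof), `analyticAt_CjOfRecord_zero`, `eventually_analyticAt_CjOfRecord_zero`.
* ★ `CslJOfRecord … j levB := CjOfRecord … j levB ∘ slProjLit` — the traceless-slice twin (3f′'s `CslOfRecord` per level; the `C`-slot shape of `Prop4Hyp (·) C₂ c₄`), with
  `CslJOfRecord_apply`, `_of_trace_eq_zero`, `_zero`, ★ `_top : CslJOfRecord … k levB = CslOfRecord … levB`, `analyticAt_CslJOfRecord_zero`.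

HONEST FRAMING.  Definitions and bookkeeping only; NOTHING of [B11] (44)∕Prop. 4 is asserted — no (44) constant, no letter (`Prop`) is introduced or re-typed, no `BjOfRecord`
(the (20) value family); JUNK exactly as 3e′ SAYS (off the log-disc `mlog` is the series' value, off the guard `iterMh` uses adjugates) — total functions whose meaning is claimed
only under displayed hypotheses; (ℓa-C) general-Ω, (ℓa-H), (ℓd), (R1)∕(R2) OPEN; K0ᴬ ⟨stmt-QuantumFields-27238⟩ NOT closed; K0ᴬ∕K1ᴬ∕K3ᴬ 0∕3; NODE O 0∕1; COUNT 8∕28 ·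
K 1∕4 UNMOVED; finite `𝕋⁴_{L^K}` at fixed ε — NOT continuum ∕ ℝ⁴ ∕ OS; **the Yang–Mills mass gap (Clay) is NOT proved by any of this.**  No `sorry`, `instance`, `notation`;
standard axioms.
-/

noncomputable section

open scoped Matrix Matrix.Norms.L2Operator InnerProductSpace ComplexConjugate Topology

namespace Summit.QuantumFields.YangMills.Theorems.C44IterMh

open Literature.MathematicalPhysics.QuantumFieldTheory.Balaban1983to89
open Literature.MathematicalPhysics.QuantumFieldTheory.Balaban1983to89.Node00
open T4Continuum BlockAveraging
open NormedSpace (exp)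
open MatrixLog (mlog mlog_one analyticAt_mlog)
open B15AveragingHolomorphic (iterMh loopMh loopMh_coeField coeField_iter_eq_iterMh coeField_avgFamily_eq_iterMh)
open B15AveragingAnalytic (analyticAt_iterMh_of_polydisc)
open B11Eq115Space (NegSize NegSup JetSup levWeight levWeight_apply)

variable (F : T4Family) (N : ℕ) [NeZero N] {K : ℕ} (k : ℕ) (Ω : ℕ → Set (Site (F.P K) 0)) (U₀ : GaugeField (F.P K) 0 (SU N))

/-! ## §1  The family `C_j` -/

variable (K) in
/-- ★★ **THE NONLINEAR CONSTRAINT REMAINDER `C_j` OF (44) AT THE RECORD, LEVEL `j`**: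
`C_j(A′)(c) = (1∕i) log( Ū^j_h(exp(iη_kA′)·U₀)(c) · (Ū^jU₀)(c)⋆ ) − (L^jη_k)·(Q_j(U₀)A′)(c)` on the level-`j` bonds `c` — the `j`-fold nonlinear average of the chart (19) in the
log-coordinate (20) MINUS `L^jη_k` times its `L^{-j}`-normalised linearisation `Q_j(U₀) = qCplxOp j U₀` ([B9] (3.13)); `Ū^j_h = iterMh j` the holomorphic extension of the (0.4) averaging
of record.  At `j = k` it IS 3e′'s `COfRecord` (`CjOfRecord_top`, `L^kη_k = 1`).  Total on level-`j` bonds; its use on the `Λ_j`-blocks of the profile `Ω` is the consumer's.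
JUNK (said, as in 3e′): off the log-disc `mlog` is the power series' value, off the small-field guard `iterMh` inverts by adjugates.
[cite: Balaban1985Variational, (44) p.285, (20) p.281, (19) p.281; Balaban1985BackgroundPropagators, (3.13) p.393; Balaban1987RG1, (0.4) p.253] -/
def CjOfRecord (j : ℕ) (levB : PBond (F.P K) j → ℕ) : Space115Lit F N K k Ω U₀ → NegSize (F.L : ℝ) ((F.P K).eta k) levB 0 (Matrix (Fin N) (Fin N) ℂ) :=
  fun A => (NegSup.equiv _ _).symm
    (logOver (coeField (Averaging.iter (avOfRecord F N K) j U₀)) (iterMh j (expOver U₀ ((((F.P K).eta k : ℝ) : ℂ) • evLit F N K k Ω U₀ A)))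
      - (((F.L : ℂ) ^ j * (((F.P K).eta k : ℝ) : ℂ))) • qCplxOp j U₀ (evLit F N K k Ω U₀ A))

/-- Unfolding of `CjOfRecord` at a bond (`rfl`). [cite: Balaban1985Variational, (44) p.285 (bookkeeping)] -/
theorem CjOfRecord_apply (j : ℕ) (levB : PBond (F.P K) j → ℕ) (A : Space115Lit F N K k Ω U₀) (c : PBond (F.P K) j) :
    NegSup.equiv _ _ (CjOfRecord F N K k Ω U₀ j levB A) c =
      (Complex.I⁻¹ : ℂ) • mlog (iterMh j (expOver U₀ ((((F.P K).eta k : ℝ) : ℂ) • evLit F N K k Ω U₀ A)) c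
          * star (Averaging.iter (avOfRecord F N K) j U₀ c : Matrix (Fin N) (Fin N) ℂ))
        - ((F.L : ℂ) ^ j * (((F.P K).eta k : ℝ) : ℂ)) • qCplxOp j U₀ (evLit F N K k Ω U₀ A) c := rfl

omit [NeZero N] in
/-- Print's scaling at the top level: `L^k·η_k = 1` (`η_k = L^{-k}`, `Params.eta`), as a complex number. [cite: Balaban1985Variational, (5) p.279, (44) p.285 (bookkeeping)] -/
theorem L_pow_mul_eta_complex : (F.L : ℂ) ^ k * (((F.P K).eta k : ℝ) : ℂ) = 1 := by
  have hL : (F.L : ℝ) ≠ 0 := by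
    have := F.hL.2
    positivity
  have h : (F.L : ℝ) ^ k * (F.P K).eta k = 1 := by
    rw [Params.eta, T4Family.P_L, ← mul_pow, mul_inv_cancel₀ hL, one_pow]
  have h' : (((F.L : ℝ) ^ k * (F.P K).eta k : ℝ) : ℂ) = 1 := by rw [h, Complex.ofReal_one]
  simpa only [Complex.ofReal_mul, Complex.ofReal_pow, Complex.ofReal_natCast] using h'

/-- ★ **AT THE TOP LEVEL `j = k` THE FAMILY MEMBER IS 3e′'s `COfRecord`** (the factor `L^kη_k` is `1`). [cite: Balaban1985Variational, (44) p.285] -/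
theorem CjOfRecord_top (levB : PBond (F.P K) k → ℕ) : CjOfRecord F N K k Ω U₀ k levB = COfRecord F N K k Ω U₀ levB := by
  funext A
  rw [CjOfRecord, COfRecord, L_pow_mul_eta_complex, one_smul]

/-- ★ **`C_j(0) = 0`** under the small-field guard of `U₀` below `j` (there `Ū^j_h(↑U₀) = ↑(Ū^jU₀)` is unitary, `log 1 = 0`, `Q_j(U₀)0 = 0`). [cite: Balaban1985Variational, (44) p.285; Balaban1987RG1, (0.4) p.253] -/
theorem CjOfRecord_zero (j : ℕ) (levB : PBond (F.P K) j → ℕ) (hU₀ : SmallBelow (avOfRecord F N K) j U₀) : CjOfRecord F N K k Ω U₀ j levB 0 = 0 := by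
  refine (NegSup.equiv _ _).injective (funext fun c => ?_)
  simp only [CjOfRecord_apply, map_zero, smul_zero, expOver_zero, iterMh_coeField_of_smallBelow F N j U₀ hU₀, coeField_apply, coe_mul_star_coe_SU,
    mlog_one, sub_zero, NegSup.equiv_zero, Pi.zero_apply]

/-- ★★ **`C_j` IS ℂ-ANALYTIC** at every `A′` whose chart field `exp(iη_kA′)U₀` has all its (0.4) loop matrices below `j` in the polydisc `‖W − 1‖ < 1` and whose relative `j`-fold
average lies in the log-disc (3e′'s `analyticAt_COfRecord` at level `j`; Sect. G). [cite: Balaban1985Variational, Sect. G p.307, (44) p.285; Balaban1985Averaging, (21) p.21; Balaban1987RG1, (0.4) p.253] -/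
theorem analyticAt_CjOfRecord [Fact (0 < (F.L : ℝ))] [Fact (0 < (F.P K).eta k)] (j : ℕ) (levB : PBond (F.P K) j → ℕ) (A : Space115Lit F N K k Ω U₀)
    (hpoly : ∀ i, i < j → ∀ (c : PBond (F.P K) (i + 1)) (a : Idx (F.P K)),
      ‖loopMh (iterMh i (expOver U₀ ((((F.P K).eta k : ℝ) : ℂ) • evLit F N K k Ω U₀ A))) c a - 1‖ < 1)
    (hlog : ∀ c : PBond (F.P K) j,
      ‖iterMh j (expOver U₀ ((((F.P K).eta k : ℝ) : ℂ) • evLit F N K k Ω U₀ A)) c * star (Averaging.iter (avOfRecord F N K) j U₀ c : Matrix (Fin N) (Fin N) ℂ) - 1‖ < 1) :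
    AnalyticAt ℂ (CjOfRecord F N K k Ω U₀ j levB) A := by
  have hev : AnalyticAt ℂ (fun Y : Space115Lit F N K k Ω U₀ => evLit F N K k Ω U₀ Y) A :=
    (LinearMap.toContinuousLinearMap (evLit F N K k Ω U₀)).analyticAt A
  have hX : AnalyticAt ℂ (fun Y : Space115Lit F N K k Ω U₀ => (((F.P K).eta k : ℝ) : ℂ) • evLit F N K k Ω U₀ Y) A := hev.fun_const_smul
  have hchart : AnalyticAt ℂ (fun Y : Space115Lit F N K k Ω U₀ => expOver U₀ ((((F.P K).eta k : ℝ) : ℂ) • evLit F N K k Ω U₀ Y)) A :=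
    (analyticAt_expOver U₀ _).comp_of_eq hX rfl
  have hiter : AnalyticAt ℂ (fun Y : Space115Lit F N K k Ω U₀ => iterMh j (expOver U₀ ((((F.P K).eta k : ℝ) : ℂ) • evLit F N K k Ω U₀ Y))) A :=
    (analyticAt_iterMh_of_polydisc j hpoly).comp_of_eq hchart rfl
  have hlin : AnalyticAt ℂ (fun Y : Space115Lit F N K k Ω U₀ =>
      ((F.L : ℂ) ^ j * (((F.P K).eta k : ℝ) : ℂ)) • qCplxOp j U₀ (evLit F N K k Ω U₀ Y)) A :=
    ((LinearMap.toContinuousLinearMap (qCplxOp j U₀ ∘ₗ evLit F N K k Ω U₀)).analyticAt A).fun_const_smul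
  have hg : AnalyticAt ℂ (fun Y : Space115Lit F N K k Ω U₀ =>
      logOver (coeField (Averaging.iter (avOfRecord F N K) j U₀)) (iterMh j (expOver U₀ ((((F.P K).eta k : ℝ) : ℂ) • evLit F N K k Ω U₀ Y)))
        - ((F.L : ℂ) ^ j * (((F.P K).eta k : ℝ) : ℂ)) • qCplxOp j U₀ (evLit F N K k Ω U₀ Y)) A := by
    refine AnalyticAt.fun_sub (analyticAt_pi_iff.2 fun c => ?_) hlin
    exact (analyticAt_logOver_apply (coeField (Averaging.iter (avOfRecord F N K) j U₀)) c (hlog c)).comp_of_eq hiter rfl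
  exact ((NegSup.continuousLinearEquiv ℂ (V := Matrix (Fin N) (Fin N) ℂ) (levWeight (F.L : ℝ) ((F.P K).eta k) levB 0)).symm.analyticAt _).comp hg

/-- ★ **`C_j` IS ℂ-ANALYTIC AT `A′ = 0`** under the small-field guard of `U₀` below `j`. [cite: Balaban1985Variational, Sect. G p.307, (44) p.285; Balaban1987RG1, (0.4) p.253] -/
theorem analyticAt_CjOfRecord_zero [Fact (0 < (F.L : ℝ))] [Fact (0 < (F.P K).eta k)] (j : ℕ) (levB : PBond (F.P K) j → ℕ)
    (hU₀ : SmallBelow (avOfRecord F N K) j U₀) : AnalyticAt ℂ (CjOfRecord F N K k Ω U₀ j levB) 0 := by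
  refine analyticAt_CjOfRecord F N k Ω U₀ j levB 0 (fun i hi c a => ?_) (fun c => ?_)
  · have hsb : SmallBelow (avOfRecord F N K) i U₀ := fun i' hi' c' => hU₀ i' (lt_trans hi' hi) c'
    rw [expOver_evLit_zero, iterMh_coeField_of_smallBelow F N i U₀ hsb, loopMh_coeField]
    exact norm_loopM_coeField_sub_one_lt_one _ c (hU₀ i hi c) a
  · rw [expOver_evLit_zero, iterMh_coeField_of_smallBelow F N j U₀ hU₀, coeField_apply, coe_mul_star_coe_SU, sub_self, norm_zero]
    exact one_pos

/-- `C_j` is ℂ-analytic at every point of a neighbourhood of `A′ = 0` (guarded `U₀`). [cite: Balaban1985Variational, Sect. G p.307, (51)–(53) p.286] -/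
theorem eventually_analyticAt_CjOfRecord_zero [Fact (0 < (F.L : ℝ))] [Fact (0 < (F.P K).eta k)] (j : ℕ) (levB : PBond (F.P K) j → ℕ)
    (hU₀ : SmallBelow (avOfRecord F N K) j U₀) : ∀ᶠ A in 𝓝 (0 : Space115Lit F N K k Ω U₀), AnalyticAt ℂ (CjOfRecord F N K k Ω U₀ j levB) A :=
  (analyticAt_CjOfRecord_zero F N k Ω U₀ j levB hU₀).eventually_analyticAt

/-! ## §2  The family on the traceless slice -/

variable (K) in
/-- ★ **`C_j` ON THE SLICE: `C_j^{𝔰𝔩}(A′) := C_j(P A′)`**, `P = slProjLit` (3f′'s traceless projection) — the level-`j` twin of `CslOfRecord`, the `C`-slot shape of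
`Prop4Hyp (·) C₂ c₄` per level (stability is on the traceless slice only — ★ PT-B (F-α)). [cite: Balaban1985Variational, (44) p.285, (51) p.286] -/
def CslJOfRecord [Fact (0 < (F.L : ℝ))] [Fact (0 < (F.P K).eta k)] (j : ℕ) (levB : PBond (F.P K) j → ℕ) :
    Space115Lit F N K k Ω U₀ → NegSize (F.L : ℝ) ((F.P K).eta k) levB 0 (Matrix (Fin N) (Fin N) ℂ) :=
  fun A => CjOfRecord F N K k Ω U₀ j levB (slProjLit F N K k Ω U₀ A)

/-- Unfolding (`rfl`). [cite: Balaban1985Variational, (44) p.285 (bookkeeping)] -/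
theorem CslJOfRecord_apply [Fact (0 < (F.L : ℝ))] [Fact (0 < (F.P K).eta k)] (j : ℕ) (levB : PBond (F.P K) j → ℕ) (A : Space115Lit F N K k Ω U₀) :
    CslJOfRecord F N K k Ω U₀ j levB A = CjOfRecord F N K k Ω U₀ j levB (slProjLit F N K k Ω U₀ A) := rfl

/-- On traceless fields `C_j^{𝔰𝔩} = C_j`. [cite: Balaban1985Variational, (51) p.286, (44) p.285] -/
theorem CslJOfRecord_of_trace_eq_zero [Fact (0 < (F.L : ℝ))] [Fact (0 < (F.P K).eta k)] (j : ℕ) (levB : PBond (F.P K) j → ℕ) {A : Space115Lit F N K k Ω U₀}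
    (hA : ∀ b, (JetSup.equiv _ _ _ A b).trace = 0) : CslJOfRecord F N K k Ω U₀ j levB A = CjOfRecord F N K k Ω U₀ j levB A := by
  rw [CslJOfRecord_apply, slProjLit_of_trace_eq_zero F N K k Ω U₀ hA]

/-- ★ At the top level the slice twin IS 3f′'s `CslOfRecord`. [cite: Balaban1985Variational, (44) p.285] -/
theorem CslJOfRecord_top [Fact (0 < (F.L : ℝ))] [Fact (0 < (F.P K).eta k)] (levB : PBond (F.P K) k → ℕ) :
    CslJOfRecord F N K k Ω U₀ k levB = CslOfRecord F N K k Ω U₀ levB := by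
  funext A
  rw [CslJOfRecord_apply, CslOfRecord_apply, CjOfRecord_top]

/-- `C_j^{𝔰𝔩}(0) = 0` under the guard below `j`. [cite: Balaban1985Variational, (44) p.285] -/
theorem CslJOfRecord_zero [Fact (0 < (F.L : ℝ))] [Fact (0 < (F.P K).eta k)] (j : ℕ) (levB : PBond (F.P K) j → ℕ) (hU₀ : SmallBelow (avOfRecord F N K) j U₀) :
    CslJOfRecord F N K k Ω U₀ j levB 0 = 0 := by
  rw [CslJOfRecord_apply, map_zero, CjOfRecord_zero F N k Ω U₀ j levB hU₀]

/-- ★ `C_j^{𝔰𝔩}` is ℂ-analytic at `A′ = 0` under the guard below `j`. [cite: Balaban1985Variational, p.290, (44) p.285] -/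
theorem analyticAt_CslJOfRecord_zero [Fact (0 < (F.L : ℝ))] [Fact (0 < (F.P K).eta k)] (j : ℕ) (levB : PBond (F.P K) j → ℕ)
    (hU₀ : SmallBelow (avOfRecord F N K) j U₀) : AnalyticAt ℂ (CslJOfRecord F N K k Ω U₀ j levB) 0 :=
  (analyticAt_CjOfRecord_zero F N k Ω U₀ j levB hU₀).comp_of_eq ((slProjLit F N K k Ω U₀).analyticAt 0) (map_zero _)

end Summit.QuantumFields.YangMills.Theorems.C44IterMh

end
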